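import Summits.BirchSwinnertonDyer.BirchSwinnertonDyer.Theorems.KatoDescentPotSupersingularCartanMuRoadFukudaDoorsWild
import Summits.BirchSwinnertonDyer.BirchSwinnertonDyer.Theorems.KatoDescentPotSupersingularModThreeNonsplitCartanCertificate
import Summits.BirchSwinnertonDyer.BirchSwinnertonDyer.Theorems.KatoDescentPotSupersingularWildUpperUnitTwistRecordsSharpPImg02
import Summits.BirchSwinnertonDyer.BirchSwinnertonDyer.Theorems.KatoDescentPotSupersingularWildUpperUnitTwistRecordsClassO601
import Summits.BirchSwinnertonDyer.BirchSwinnertonDyer.Theorems.KatoDescentPotSupersingularWildUpperUnitTwistRecordsClassO626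
import Summits.BirchSwinnertonDyer.BirchSwinnertonDyer.Theorems.KatoDescentPotSupersingularWildUpperUnitTwistRecordsSharpPImg10
import Literature.NumberTheory.EllipticCurves.ModThreeImageCubeDiscriminantProofs
import HarnessLib

/-!
# Route `KatoDescentPotSupersingular` (rung K9, sub-rung B5 = O6 wild `p = 3`, cell `bsd-potss`): per-row U₀ RECORDS BY FUKUDA'S LAYER CRITERION ON THE MAXIMAL REAL
# SUBFIELD `K⁺ = ℚ(E[3])^c ≅ ℚ(P)` (degree 8, `3Nn` rows) WITH THE IMAGE EQUALITY `Im ρ̄₃ = C_ns⁺(3)` CERTIFIED IN THE KERNEL — a SECOND road beside the unit-twist records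
# for the `3Nn` rows on which every road on `L = ℚ(E[3])` is silent (off the Iwasawa-1956 / Fukuda-on-`L` lists of k9-c4 g22), part 01: 100467d1, 499230f1
# (seat `bsd-potss-k9-c4` g23; doors `CartanMuRoadFukudaDoorsWild.missingUpperBoundAt_three_of_hasModPImageEqNonsplitCartanNormalizer_of_real{,Rank}SuccEqAt'` (k8t-c4 g19,
# `hram`-free); image tool `ModThreeNonsplitCartanCertificate.…_of_intModel` (k9-c4 g18, shape of `…WildConjAResidueCartanRowsNnImg01–04`); `--supports stmt-BirchSwinnertonDyer-19197 --as helper`)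

HONEST FRAMING. THEOREMS ONLY (no definition, no named fact, no `sorry`); PER ROW — NOT a class theorem; nothing is booked; items 19189 / 19197 stay OPEN at class level
(class-wide open input: the zeta crux 24327); (A), Conjecture A and BSD are proved for NO curve here.  ROAD = `MissingUpperBoundAt E 3 ⟸` NAMED FACTS `hKatoA hGZK hmod hCS
hI hFW hF1` (resp. `hF2`) `+` Cremona's `r_an = 0` (`hr`) `+` KERNEL (`Δ ≠ 0`, minimality, `irr_g…_3`, `classO6_g…_3`, `ρ̄₃` not onto from `Δ = s³`, image `= C_ns⁺(3)` from an
order-`8` Frobenius) `+` a complex conjugation `c` (`hc`, exists) `+` ONE NUMERIC hypothesis `hord : e_{n+1}(K⁺) = e_n(K⁺)` (resp. `hrk`) for every cyclotomic `ℤ₃`-extension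
of `K⁺ := Fix(c|_L)` — on a `3Nn` row `K⁺` has degree `8` and `μ(L_cyc) = 0 ⟸ μ(K⁺_cyc) = 0` (k9-c4 g18's one-field door `CartanMuRoadRealDoors.…realMu'`, Iwasawa growth
fact `hI`, Ferrero–Washington `hFW`), `μ(K⁺_cyc) = 0 ⟸` Fukuda 1994 Thm. 1 at layers `(n, n+1)` (named fact) with the index hypothesis discharged by Serre's Prop. 15
inside the door.  NUMERICS (quoted per row, not kernel-checked): THIS SEAT's kit j315922 (`ug8nn.gp`, PARI 2.17; engine = conjA-anchor g14's door-UG `ug12.gp` /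
k9-c4 g21's `ug12_q1.gp` re-targeted): the octic `ℚ(P)` from the irreducible `ψ₃`, `h(K⁺)` (+ `bnfcertify`), `h(K⁺₁)` on the degree-24 layer (GRH unless certified),
Fukuda's `(0,1)` verdict, and door UG at `(0,1)` / `(1,2)` (where UG passes, the displayed layer equality is a consequence of the tree theorem
`IwasawaTheory.classNumberPExp_succ_eq_of_sup_eq_top` applied to the quoted layer data).  Regression row 406593q1 (k9-c4 g19/g21: every layer-≤1 criterion shut) is
re-run by the same job and NOT recorded here.  No degree-72 field enters.

References: [Fukuda1994] Thm. 1; [Serre1972] §2.2–§2.6, §5.2; [Serre1981] §8.1; [FerreroWashington1979]; [Washington1997] §13.1; [CoatesSujatha2005] 3.4;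
[Kato2004Asterisque] 12.5 (3), 14.5 (3); [Lang1990] Ch. 13 §4; [Cremona2006].
-/

set_option autoImplicit false
set_option linter.dupNamespace false

noncomputable section

open scoped Classical NumberField
open Polynomial WeierstrassCurve NumberField IsDedekindDomain IsDedekindDomain.HeightOneSpectrum Rat.HeightOneSpectrum Field IntermediateField
  Literature.NumberTheory.DiophantineGeometry Literature.NumberTheory.EllipticCurves
  Literature.NumberTheory.EllipticCurves.ModularForms Literature.NumberTheory.EllipticCurves.Rank1Residual
  Literature.NumberTheory.EllipticCurves.Rank1Residual.Typed Literature.NumberTheory.Automorphic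
  Literature.NumberTheory.EllipticCurves.Rank1Residual.X11RankOneCertificates
  Literature.NumberTheory.GaloisRepresentations Literature.NumberTheory.SerreUniformity Literature.NumberTheory.IwasawaTheory
  Summit.BirchSwinnertonDyer.BirchSwinnertonDyer.Rank1Residual.IntModel
  Summit.BirchSwinnertonDyer.BirchSwinnertonDyer.Rank1Residual.X11RankOne
  Summit.BirchSwinnertonDyer.Rank1Residual Summit.BirchSwinnertonDyer.Rank1Residual.Additive
  Summit.BirchSwinnertonDyer.Rank1Residual.X11b Summit.BirchSwinnertonDyer.Rank1Residual.Supersingular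
  Summit.BirchSwinnertonDyer.BirchSwinnertonDyer.Rank2Observatory.RootNumber
  Summit.BirchSwinnertonDyer.BirchSwinnertonDyer.Theorems
  Summit.BirchSwinnertonDyer.BirchSwinnertonDyer.Theorems.TameUpperUnitTwistRecords

namespace Summit.BirchSwinnertonDyer.BirchSwinnertonDyer.Theorems.WildUpperUnitTwistRecords

/-! ### `100467d1` @ `p = 3` — `N = 100467 = 3^3·61^2`; Cremona: `r_an = 0`; O6 wild at `3`; image `3Nn` (census) — CERTIFIED below (Frobenius witness `ℓ = 11`, `#Ẽ(𝔽_{11}) = 10`,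
`a_{11} = 2`); first road: k9-c4 g16/g17 unit-twist record `missingUpperBoundAt_g100467d1_3`; conjA-anchor g8 / k9-c4 g22: every road on `L = ℚ(E[3])` (degree 16) silent at layers `(0,1)`;
kernel lemmas in `…WildUpperUnitTwistRecordsClassO601` (`classO6`) / `…WildUpperUnitTwistRecordsFlat03` (`irr`, `isElliptic`, `isGloballyMinimal`); `notSurjThree_g100467d1` proved here (♭ row).
KIT j315922 (this seat, `ug8nn.gp`): `ψ₃/3 = x^4-x^3-425589*x^2-105361743*x-15067492641` IRREDUCIBLE over `ℚ` (`N_ns(3)` is transitive on the `8` points of order `3` ⇒ `ℚ(P)` unique up to isomorphism);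
`K⁺ ≅ ℚ(P) ≅ ℚ[x]/(x^8-2*x^7+2*x^6+14*x^5-9*x^4-105*x^3-162*x^2-117*x-27)` (degree 8, signature `[2,3]`): `h = 3` (`Cl ≅ [3]`, CERTIFIED), primes above `3`: `[[1,1],[2,1],[2,1],[2,1],[1,1]]`; `K⁺₁ = K⁺·ℚ(ζ₉)⁺` (degree 24):
`h = 27` (`Cl ≅ [9,3]`, GRH), primes above `3`: `[[3,1],[6,1],[3,1],[6,1],[6,1]]` ⟹ `e₀ = 1 < e₁ = 3` (layer `(0,1)` silent) but door UG PASSES at `(1,2)` ⟹ `e₂(K⁺) = e₁(K⁺) = 3` (Fukuda Thm. 1 (1) at `(1,2)`).  Door UG (tree theorem p644996) at `(0,1)`: UG-FAIL(0,1): gen 1 totram 1 unit-index 0 (rank 2 of 4); at `(1,2)`: UG-PASS(1,2): ord_3 h(K+_2) = ord_3 h(K+_1) => e_2 = e_1 = 3. -/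

/-- **`ρ̄_(E,3)` is NOT surjective for `E = 100467d1`** (kernel: `Δ(E) = (680943)³` on the integral model `[1, (-1), 1, (-212795), (-26340436)]`; Serre: `ℚ(E[3]) ⊇ ℚ(μ₃, ∛Δ)`, so a
surjective image forces `Δ ∉ ℚ׳`; tree THEOREM `ModThreeImage.not_hasSurjectiveModNGaloisRep_three_of_Δ_eq_cube`; k9-c4 g17's `…SharpImg` shape, here for a ♭ `3Nn` row).
[cite: Serre1972, §5.3] [cite: SilvermanAEC2009, III.1] [cite: Cremona2006, Table 1 (Cremona label 100467d1)] -/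
theorem notSurjThree_g100467d1 {W : WeierstrassCurve ℚ} [W.IsElliptic] [W.IsGloballyMinimal]
    (hI : integralModelInt W = ((⟨1, (-1), 1, (-212795), (-26340436)⟩ : WeierstrassCurve ℤ) : WeierstrassCurve ℤ)) : ¬ W.HasSurjectiveModNGaloisRep 3 := by
  have hD : discOf [1, (-1), 1, (-212795), (-26340436)] = 315741944506521807 := by decide +kernel
  have hΔ : W.Δ = ((315741944506521807 : ℤ) : ℚ) := by rw [Δ_eq_cast hI, intCurve_Δ, hD]
  exact ModThreeImage.not_hasSurjectiveModNGaloisRep_three_of_Δ_eq_cube W (d := ((680943 : ℤ) : ℚ)) (by rw [hΔ]; norm_num)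

/-- **KERNEL IMAGE CERTIFICATE `3Nn` for `100467d1`**: the mod-`3` image EQUALS the normaliser of a non-split Cartan subgroup
(`HasModPImageEqNonsplitCartanNormalizer E 3`) — from `E[3]` irreducible (`irr_g100467d1_3`), `ρ̄₃` not onto (`notSurjThree_g100467d1`, `Δ` a cube)
and the Frobenius at `ℓ = 11` (`ℓ ≡ −1 (mod 3)`, `#Ẽ(𝔽_{11}) = 10`, `a_ℓ = 2 ≢ 0 (mod 3)`: an element of order `8` on `E[3]`), by k9-c4 g18's tool
`ModThreeNonsplitCartanCertificate.hasModPImageEqNonsplitCartanNormalizer_three_of_intModel` (Serre 1972 §2). Hitherto a census datum (LMFDB `3Nn`).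
[cite: Serre1972, §2.2, §2.4 Prop. 15] [cite: Serre1981, §8.1 (238)] [cite: Cremona2006, Table 1 (Cremona label 100467d1)] -/
theorem hasModPImageEqNonsplitCartanNormalizer_g100467d1_3 : HasModPImageEqNonsplitCartanNormalizer (⟨1, (-1), 1, (-212795), (-26340436)⟩ : WeierstrassCurve ℚ) 3 := by
  haveI := isElliptic_g100467d1
  haveI := isGloballyMinimal_g100467d1
  haveI : Fact (Nat.Prime 11) := ⟨by norm_num⟩
  have hI : integralModelInt (⟨1, (-1), 1, (-212795), (-26340436)⟩ : WeierstrassCurve ℚ) = (⟨1, (-1), 1, (-212795), (-26340436)⟩ : WeierstrassCurve ℤ) :=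
    integralModelInt_eq_of_map_eq _ (map_mk_int 1 (-1) 1 (-212795) (-26340436))
  have hc : Nat.card (((((⟨1, (-1), 1, (-212795), (-26340436)⟩ : WeierstrassCurve ℤ))).map (Int.castRingHom (ZMod 11))).toAffine.Point) = 10 := by
    have h := natCard_point_eq_countPoints 1 (-1) 1 (-212795) (-26340436) 11 (by norm_num) (by decide +kernel)
    have h' : countPoints [1, (-1), 1, (-212795), (-26340436)] 11 = 10 := countPoints_eq_of_fast (by decide +kernel)
    exact_mod_cast h.trans h'
  exact ModThreeNonsplitCartanCertificate.hasModPImageEqNonsplitCartanNormalizer_three_of_intModel hI irr_g100467d1_3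
    (notSurjThree_g100467d1 hI) 11 (by norm_num) (by decide +kernel) hc (by decide) (by decide)

/-- **RECORD (second road, on the real octic `K⁺ = ℚ(E[3])^c ≅ ℚ(P)`) — UPPER half `ord₃ #Ш(E) ≤ ord₃ #Ш(E)_an` for `E = 100467d1` at `p = 3` FROM ONE FUKUDA EQUALITY
`e_2(K⁺) = e_1(K⁺)`** (U₀-ns row of K9 items 19189 / 19197; door `CartanMuRoadFukudaDoorsWild.missingUpperBoundAt_three_of_hasModPImageEqNonsplitCartanNormalizer_of_realSuccEqAt'`,
n = 1, `hram`-free, paying Iwasawa's growth fact `hI`).  KERNEL (imported / above): `Δ ≠ 0`, minimality, `irr_g100467d1_3`, `classO6_g100467d1_3`, image `= C_ns⁺(3)`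
(`hasModPImageEqNonsplitCartanNormalizer_g100467d1_3`).  DISPLAYED: named facts `hKatoA hGZK hmod hCS hI hFW hF1`; Cremona's `r_an = 0` (`hr`); a complex conjugation `c`
(`hc`); `hord : e_2(K⁺) = e_1(K⁺)` for `K⁺ = Fix(c|_L)` (numerically `3 = 1`: `K⁺₁`: `Cl ≅ [9,3]` GRH (`bnfcertify` did not finish in 600 s); `ord₃ h(K⁺₂) = ord₃ h(K⁺₁)` by door UG from these layer-1 data (kit j315922; tree theorem p644996) — no degree-72 field).  Per row; CONDITIONAL; nothing booked; BSD is not proved by this.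
[cite: Kato2004Asterisque, Thm. 14.5 (3) (p. 236), Thm. 12.5 (3) (p. 222)] [cite: Fukuda1994, Thm. 1 (1), p. 264] [cite: CoatesSujatha2005, Thm. 3.4 (§3)] [cite: Serre1972, §2.4 Prop. 15, §5.2 (iv)]
[cite: Washington1997, §13.1] [cite: Cremona2006, Table 1 (Cremona label 100467d1)] -/
theorem missingUpperBoundAt_g100467d1_3_fkK12
    (hKatoA : Kato2004.rankZero_padicValNat_sha_add_padicValNat_tamagawa_le_of_additive_potGood_of_irreducible_of_fineSelmerDual_fg)
    (hGZK : rank_eq_analyticRank_of_analyticRank_le_one) (hmod : hasEntireLFunction_rat)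
    (hCS : CoatesSujatha2005.thm34_fineSelmerDual_moduleFinite_of_classicalMuVanishes_divisionField)
    (hI : iwasawa1959_classNumberPExp_growth) (hFW : ferreroWashington1979_classicalMuVanishes)
    (hF1 : fukuda1994_thm1_classNumberPExp_const_of_succ_eq)
    {W : WeierstrassCurve ℚ} [W.IsElliptic] [W.IsGloballyMinimal] (hWeq : W = (⟨1, (-1), 1, (-212795), (-26340436)⟩ : WeierstrassCurve ℚ)) (hr : W.analyticRank = 0)
    {c : absoluteGaloisGroup ℚ} (hc : IsComplexConjugation (Rat.castHom ℝ) c)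
    (hord : haveI : NumberField ↥(W.divisionField 3) := NumberField.mk
      ∀ κE : ZpExtension ↥(fixedField (Subgroup.zpowers (absRestrictNormalHom (W.divisionField 3) c))) 3,
        κE.IsCyclotomic → classNumberPExp κE (1 + 1) = classNumberPExp κE 1) :
    MissingUpperBoundAt W 3 := by
  subst hWeq
  haveI : Fact (Nat.Prime 3) := ⟨Nat.prime_three⟩
  exact CartanMuRoadFukudaDoorsWild.missingUpperBoundAt_three_of_hasModPImageEqNonsplitCartanNormalizer_of_realSuccEqAt' _ hKatoA hGZK hmod hCS hI hFW hF1
    hr classO6_g100467d1_3 irr_g100467d1_3 hasModPImageEqNonsplitCartanNormalizer_g100467d1_3 hc 1 hord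

/-! ### `499230f1` @ `p = 3` — `N = 499230 = 2·3^3·5·43^2`; Cremona: `r_an = 0`; O6 wild at `3`; image `3Nn` (census) — CERTIFIED below (Frobenius witness `ℓ = 11`, `#Ẽ(𝔽_{11}) = 7`,
`a_{11} = 5`); first road: k9-c4 g16/g17 unit-twist record `missingUpperBoundAt_g499230f1_3`; conjA-anchor g8 / k9-c4 g22: every road on `L = ℚ(E[3])` (degree 16) silent at layers `(0,1)`;
kernel lemmas in `…WildUpperUnitTwistRecordsClassO626` (`classO6`) / `…WildUpperUnitTwistRecordsSharpP31` (`irr`, `isElliptic`, `isGloballyMinimal`); `notSurjThree_g499230f1` in `…WildUpperUnitTwistRecordsSharpPImg10`.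
KIT j315922 (this seat, `ug8nn.gp`): `ψ₃/3 = x^4-x^3-211180530*x^2-1135589760076*x-3716150790150056` IRREDUCIBLE over `ℚ` (`N_ns(3)` is transitive on the `8` points of order `3` ⇒ `ℚ(P)` unique up to isomorphism);
`K⁺ ≅ ℚ(P) ≅ ℚ[x]/(x^8-2*x^7+x^6-32*x^5+28*x^4+4*x^3+127*x^2-194*x-125)` (degree 8, signature `[2,3]`): `h = 3` (`Cl ≅ [3]`, CERTIFIED), primes above `3`: `[[8,1]]`; `K⁺₁ = K⁺·ℚ(ζ₉)⁺` (degree 24):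
`h = 3` (`Cl ≅ [3]`, GRH), primes above `3`: `[[24,1]]` ⟹ `e₁(K⁺) = e₀(K⁺) = 1` (Fukuda Thm. 1 (1) at `(0,1)`).  Door UG (tree theorem p644996) at `(0,1)`: UG-FAIL(0,1): gen 0 totram 1 unit-index 1 (rank 0 of 0); at `(1,2)`: UG-FAIL(1,2): gen 0 totram 1 unit-index 1 (rank 0 of 0). -/

/-- **KERNEL IMAGE CERTIFICATE `3Nn` for `499230f1`**: the mod-`3` image EQUALS the normaliser of a non-split Cartan subgroup
(`HasModPImageEqNonsplitCartanNormalizer E 3`) — from `E[3]` irreducible (`irr_g499230f1_3`), `ρ̄₃` not onto (`notSurjThree_g499230f1`, `Δ` a cube)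
and the Frobenius at `ℓ = 11` (`ℓ ≡ −1 (mod 3)`, `#Ẽ(𝔽_{11}) = 7`, `a_ℓ = 5 ≢ 0 (mod 3)`: an element of order `8` on `E[3]`), by k9-c4 g18's tool
`ModThreeNonsplitCartanCertificate.hasModPImageEqNonsplitCartanNormalizer_three_of_intModel` (Serre 1972 §2). Hitherto a census datum (LMFDB `3Nn`).
[cite: Serre1972, §2.2, §2.4 Prop. 15] [cite: Serre1981, §8.1 (238)] [cite: Cremona2006, Table 1 (Cremona label 499230f1)] -/
theorem hasModPImageEqNonsplitCartanNormalizer_g499230f1_3 : HasModPImageEqNonsplitCartanNormalizer (⟨1, (-1), 0, (-105590265), (-283897440019)⟩ : WeierstrassCurve ℚ) 3 := by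
  haveI := isElliptic_g499230f1
  haveI := isGloballyMinimal_g499230f1
  haveI : Fact (Nat.Prime 11) := ⟨by norm_num⟩
  have hI : integralModelInt (⟨1, (-1), 0, (-105590265), (-283897440019)⟩ : WeierstrassCurve ℚ) = (⟨1, (-1), 0, (-105590265), (-283897440019)⟩ : WeierstrassCurve ℤ) :=
    integralModelInt_eq_of_map_eq _ (map_mk_int 1 (-1) 0 (-105590265) (-283897440019))
  have hc : Nat.card (((((⟨1, (-1), 0, (-105590265), (-283897440019)⟩ : WeierstrassCurve ℤ))).map (Int.castRingHom (ZMod 11))).toAffine.Point) = 7 := by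
    have h := natCard_point_eq_countPoints 1 (-1) 0 (-105590265) (-283897440019) 11 (by norm_num) (by decide +kernel)
    have h' : countPoints [1, (-1), 0, (-105590265), (-283897440019)] 11 = 7 := countPoints_eq_of_fast (by decide +kernel)
    exact_mod_cast h.trans h'
  exact ModThreeNonsplitCartanCertificate.hasModPImageEqNonsplitCartanNormalizer_three_of_intModel hI irr_g499230f1_3
    (notSurjThree_g499230f1 hI) 11 (by norm_num) (by decide +kernel) hc (by decide) (by decide)

/-- **RECORD (second road, on the real octic `K⁺ = ℚ(E[3])^c ≅ ℚ(P)`) — UPPER half `ord₃ #Ш(E) ≤ ord₃ #Ш(E)_an` for `E = 499230f1` at `p = 3` FROM ONE FUKUDA EQUALITY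
`e_1(K⁺) = e_0(K⁺)`** (U₀-ns row of K9 items 19189 / 19197; door `CartanMuRoadFukudaDoorsWild.missingUpperBoundAt_three_of_hasModPImageEqNonsplitCartanNormalizer_of_realSuccEqAt'`,
n = 0, `hram`-free, paying Iwasawa's growth fact `hI`).  KERNEL (imported / above): `Δ ≠ 0`, minimality, `irr_g499230f1_3`, `classO6_g499230f1_3`, image `= C_ns⁺(3)`
(`hasModPImageEqNonsplitCartanNormalizer_g499230f1_3`).  DISPLAYED: named facts `hKatoA hGZK hmod hCS hI hFW hF1`; Cremona's `r_an = 0` (`hr`); a complex conjugation `c`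
(`hc`); `hord : e_1(K⁺) = e_0(K⁺)` for `K⁺ = Fix(c|_L)` (numerically `1 = 1`: `h(K⁺) = 3` CERTIFIED, `h(K⁺₁) = 3` GRH (`bnfcertify` did not finish in 600 s), kit j315922).  Per row; CONDITIONAL; nothing booked; BSD is not proved by this.
[cite: Kato2004Asterisque, Thm. 14.5 (3) (p. 236), Thm. 12.5 (3) (p. 222)] [cite: Fukuda1994, Thm. 1 (1), p. 264] [cite: CoatesSujatha2005, Thm. 3.4 (§3)] [cite: Serre1972, §2.4 Prop. 15, §5.2 (iv)]
[cite: Washington1997, §13.1] [cite: Cremona2006, Table 1 (Cremona label 499230f1)] -/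
theorem missingUpperBoundAt_g499230f1_3_fkK01
    (hKatoA : Kato2004.rankZero_padicValNat_sha_add_padicValNat_tamagawa_le_of_additive_potGood_of_irreducible_of_fineSelmerDual_fg)
    (hGZK : rank_eq_analyticRank_of_analyticRank_le_one) (hmod : hasEntireLFunction_rat)
    (hCS : CoatesSujatha2005.thm34_fineSelmerDual_moduleFinite_of_classicalMuVanishes_divisionField)
    (hI : iwasawa1959_classNumberPExp_growth) (hFW : ferreroWashington1979_classicalMuVanishes)
    (hF1 : fukuda1994_thm1_classNumberPExp_const_of_succ_eq)
    {W : WeierstrassCurve ℚ} [W.IsElliptic] [W.IsGloballyMinimal] (hWeq : W = (⟨1, (-1), 0, (-105590265), (-283897440019)⟩ : WeierstrassCurve ℚ)) (hr : W.analyticRank = 0)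
    {c : absoluteGaloisGroup ℚ} (hc : IsComplexConjugation (Rat.castHom ℝ) c)
    (hord : haveI : NumberField ↥(W.divisionField 3) := NumberField.mk
      ∀ κE : ZpExtension ↥(fixedField (Subgroup.zpowers (absRestrictNormalHom (W.divisionField 3) c))) 3,
        κE.IsCyclotomic → classNumberPExp κE (0 + 1) = classNumberPExp κE 0) :
    MissingUpperBoundAt W 3 := by
  subst hWeq
  haveI : Fact (Nat.Prime 3) := ⟨Nat.prime_three⟩
  exact CartanMuRoadFukudaDoorsWild.missingUpperBoundAt_three_of_hasModPImageEqNonsplitCartanNormalizer_of_realSuccEqAt' _ hKatoA hGZK hmod hCS hI hFW hF1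
    hr classO6_g499230f1_3 irr_g499230f1_3 hasModPImageEqNonsplitCartanNormalizer_g499230f1_3 hc 0 hord

end Summit.BirchSwinnertonDyer.BirchSwinnertonDyer.Theorems.WildUpperUnitTwistRecords

end
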